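import Summits.QuantumFields.GaugeBoot.Certificates.N2c2D4TabA
import HarnessLib

/-!
# Kernel checks of the reduced problem family `N2c2D4` (interface only — sweep route) (gb_lean_emit_reduced 0.8.6)

HONEST FRAMING (cell `pub-gaugeboot`): certified bounds on lattice expectations at stated coupling,
gauge group, dimension and torus size; NOT a mass gap, NOT a continuum limit, NOT a string tension;
NOT Yang–Mills-summit-bearing (barriers `FixedCouplingUltralocality`, `PerturbativeInvisibility`).
Family `N2c2D4` (4480 variables, 34 reduced blocks of dimensions `dimL`, max 42; signature sha256
`1010e59a763bb6c62fc4e2aca203df8058838c2cc9a3fe3a7b51281691620d46`): SWEEP ROUTE (emitter ≥ 0.8.5) — `N2c2D4TabA` assembles the entry tables `EB` and runs the ONE β-independent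
kernel check `dimCheck` (entries outside a block's own dimension are empty); there are NO position lists, shape or cover checks:
each certificate module verifies its trace table by the entry sweep of `Certificates/SparseReducedSweepU.lean`; the interface
`dim`/`ent`/`redBlock`/`redBlock_apply` is in `N2c2D4Tab`.
SWEEP ROUTE (emitter 0.8.5): the certificate modules of this family verify their trace tables by the entry sweep of `Certificates/SparseReducedSweepU.lean` (no position lists, no shape/cover checks); this module only states the INTERFACE `dim`/`ent`/`redBlock`/`redBlock_apply` over `EB` of `N2c2D4TabA`.
Nothing is claimed about lattice gauge theory in this file.
-/

namespace Summit.QuantumFields.GaugeBoot.Certificates.N2c2D4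

noncomputable section

open Matrix Summit.QuantumFields.GaugeBoot.Certificates.Sparse


/-! ## Interface (what a lattice binding consumes) -/

/-- Dimension of reduced block `k`. -/
def dim (k : Fin 34) : ℕ := dimL.getD k.val 0

/-- The combination `[(w, c), …]` at entry `(i, j)` of reduced block `k` (symmetric; the problem file's
`psd_blocks[k].entries["min(i,j),max(i,j)"]`; empty outside the block). -/
def ent (k : Fin 34) (i j : ℕ) : List (ℕ × ℤ) := Sparse.ent EB k.val i j

/-- **Reduced block `k` as a real matrix-valued linear form** in its own dimension `dim k`. -/
def redBlock (k : Fin 34) (y : Fin 4480 → ℝ) : Matrix (Fin (dim k)) (Fin (dim k)) ℝ :=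
  Sparse.redE EB k.val (dim k) 4480 y

/-- `redBlock` unfolds to `Sparse.redE` (the form used by the certificate modules). -/
theorem redBlock_eq (k : Fin 34) (y : Fin 4480 → ℝ) :
    redBlock k y = Sparse.redE EB k.val (dimL.getD k.val 0) 4480 y := rfl

/-- **Binding interface**: `redBlock k y i j = Σ_{(w,c) ∈ ent k i j} c · y_w`. -/
theorem redBlock_apply (k : Fin 34) (y : Fin 4480 → ℝ) (i j : Fin (dim k)) :
    redBlock k y i j = Sparse.evalComb (ent k i.val j.val) y := rfl

end

end Summit.QuantumFields.GaugeBoot.Certificates.N2c2D4
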